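import Literature.Combinatorics.Optimization.ShellLawEdgeProduct
import HarnessLib

/-!
# The coloured edge-product formula (any number of blocks) and the universal exchange identity

`ShellLawEdgeProduct.lean` grades the subsets `U` of a `π`-stable ground set `S` (a set of edges of the
perfect matching `π`) by `(|U ∩ H|, |full U|, |half U|)` for ONE block `H` and proves the edge-product
formula `Ψ_S = Π_{v ∈ reps S} (1 + Z·X^{[πv∈H]} + Z·X^{[v∈H]} + Y²·X^{[v∈H]+[πv∈H]})`. Here the block weight
`X^{|U∩H|}` is replaced by an ARBITRARY multiplicative vertex weight `Π_{u ∈ U} ξ(u)` with values in any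
commutative ring `R` ("colours"): the same one-edge induction gives

> `Σ_{U ⊆ S} (Π_{u∈U} ξ u) · Y^{|full U|} · Z^{|half U|} = Π_{v ∈ reps S} (1 + Z·ξ(πv) + Z·ξ(v) + Y²·ξ(v)ξ(πv))`
> (`colourGF_eq_prod`; a polynomial in `Z` over polynomials in `Y` over `R`).

With `ξ(u) = X^{[u∈H]}` this is the one-block formula; with `ξ(u) = X₁^{[u∈H₁]}·X₂^{[u∈H₂]}` (in
`R = ℝ[X₁, X₂]`) it is the TWO-BLOCK formula `Σ_U X₁^{|U∩H₁|} X₂^{|U∩H₂|} Y^{|full U|} Z^{|half U|} = Π_v (…)`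
(`twoBlockGF_eq_prod`), whose edge factor `A_{ab} = 1 + Z(ξ_a+ξ_b) + Y²ξ_aξ_b` depends only on the
colour pair `(ξ(v), ξ(πv))` of the edge; any number of blocks likewise. The **universal exchange
identity** (`edgeFactor_exchange`)

> `A_{ab}·A_{cd} − A_{ac}·A_{bd} = (Y² − Z²)·(a − d)·(b − c)`

contains every multi-block TYPE STEP: trading an `(a,b)`-edge and a `(c,d)`-edge for an `(a,c)`- and a
`(b,d)`-edge multiplies the generating function of the common remainder by `(Y²−Z²)` times a product of
two FIRST differences — `(1−X)²` for one block (`typeStep_factor` of `ShellLawEdgeProduct.lean` is the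
instance `a = b = X`, `c = d = 1`), and `(X₁−X₂)²`, `(1−X₁)(1−X₂)`, `(X₁−1)(X₁−X₂)` for the three
genuinely two-block steps (`edgeFactor_exchange_11_22`, `_12_00`, `_11_20`).

All PROVED, 0 sorry, no definitions, no named facts; cell pnp-psdrank (eng g21, MEMO-20 §6: the identity
was found and checked in exact arithmetic while building the two-block shell-law primitive).

RELATION TO `ShellLawWeightedEdgeProduct.lean` (lit g32, landed the same hour; recorded 2026-08-28, eng g21):
§1–§3 and the coefficient extraction of §5 here duplicate that file under different names —
`colourGF_eq_prod` ≙ `wShellGF_eq_prod`, `edgeFactor_exchange` ≙ `edgeFactor_swap`,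
`coeff_coeff_colourGF` ≙ `coeff_coeff_wShellGF`, `prod_pow_ite_mem_mul_eq` ≙ `prod_blockWeight₂` — and
consumers should cite the lit file for those. NOT in the lit file and the reason this leaf is kept:
§4 `twoBlockGF_eq_prod_pairs` (the product grouped over the nine ordered colour pairs, i.e. over the
`(H₁,H₂)`-TYPE of the matching that eng MEMO-20's CG2SYM reduction is indexed by) and §5
`twoBlockGen_eq_of_pairs_eq` (transport: equal nine colour-pair counts ⇒ equal joint shell generating
polynomial for all `(t, c)`). Conversely the lit file has the type step on one ground set
(`wShellGF_typeStep`, `wShellGen_typeStep`) and the joint COUNT as a coefficient (`coeff_coeff_wShellGen₂`),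
which are not repeated here.

## References

* [Rothvoss2017] T. Rothvoß, *The matching polytope has exponential extension complexity*, J. ACM 64
  (2017), §2 (cuts and their partition by a perfect matching; PDF pp. 5–6).
* [GodsilMeagher2015] C. Godsil, K. Meagher, *Erdős–Ko–Rado Theorems: Algebraic Approaches* (2015),
  §15.2 (perfect matchings as fixed-point-free involutions).
-/

noncomputable section

open Finset Polynomial

namespace Literature.Combinatorics.Optimization

namespace ShellStep

variable {n : ℕ} {π : Fin n → Fin n}

section Coloured

variable {R : Type*} [CommRing R]
variable (hπ : ∀ v, π (π v) = v) (hπ' : ∀ v, π v ≠ v)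
include hπ hπ'

/-! ### §1 The coloured edge-product formula -/

/-- **One more edge, coloured weights.** For a `π`-stable universe `S₀`, an edge `{v, πv}` outside it
and any vertex weight `ξ : Fin n → R`, summing `(Π_{u∈U} ξ u)·Y^{|full U|}·Z^{|half U|}` over the
subsets of `S₀ ∪ {v, πv}` multiplies the sum over the subsets of `S₀` by the edge factor
`1 + Z·ξ(πv) + Z·ξ(v) + Y²·ξ(v)ξ(πv)`. [cite: Rothvoss2017, §2 (PDF p. 5)] -/
theorem colourGF_insert_insert (ξ : Fin n → R) {S₀ : Finset (Fin n)} {v : Fin n} (hv : v ∉ S₀)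
    (hπv : π v ∉ S₀) :
    ∑ U ∈ (insert v (insert (π v) S₀)).powerset,
        Polynomial.C (Polynomial.C (∏ u ∈ U, ξ u) * (Polynomial.X : Polynomial R) ^ (full π U).card) *
          (Polynomial.X : Polynomial (Polynomial R)) ^ (half π U).card =
      (∑ U ∈ S₀.powerset,
        Polynomial.C (Polynomial.C (∏ u ∈ U, ξ u) * (Polynomial.X : Polynomial R) ^ (full π U).card) *
          (Polynomial.X : Polynomial (Polynomial R)) ^ (half π U).card) *
      (1 + Polynomial.X * Polynomial.C (Polynomial.C (ξ (π v)))
         + Polynomial.X * Polynomial.C (Polynomial.C (ξ v))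
         + Polynomial.C ((Polynomial.X : Polynomial R) ^ 2 * Polynomial.C (ξ v * ξ (π v)))) := by
  classical
  have hvπ : v ≠ π v := fun h => hπ' v h.symm
  have hv' : v ∉ insert (π v) S₀ := by rw [mem_insert]; exact fun h => h.elim (fun h => hvπ h) hv
  -- the three shifted sums
  have hA : ∑ U ∈ S₀.powerset,
      Polynomial.C (Polynomial.C (∏ u ∈ insert (π v) U, ξ u) *
          (Polynomial.X : Polynomial R) ^ (full π (insert (π v) U)).card) *
        (Polynomial.X : Polynomial (Polynomial R)) ^ (half π (insert (π v) U)).card =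
      (∑ U ∈ S₀.powerset,
        Polynomial.C (Polynomial.C (∏ u ∈ U, ξ u) * (Polynomial.X : Polynomial R) ^ (full π U).card) *
          (Polynomial.X : Polynomial (Polynomial R)) ^ (half π U).card) *
      (Polynomial.X * Polynomial.C (Polynomial.C (ξ (π v)))) := by
    rw [sum_mul]
    refine sum_congr rfl fun U hU => ?_
    have hUS : U ⊆ S₀ := mem_powerset.1 hU
    have h1 : π v ∉ U := fun h => hπv (hUS h)
    have h2 : π (π v) ∉ U := by rw [hπ]; exact fun h => hv (hUS h)
    rw [half_insert_of_notMem hπ hπ' h1 h2, full_insert_of_notMem hπ hπ' h1 h2,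
      card_insert_of_notMem (fun h => h1 (mem_half.1 h).1), prod_insert h1, pow_succ]
    simp only [map_mul]
    ring
  have hB : ∑ U ∈ S₀.powerset,
      Polynomial.C (Polynomial.C (∏ u ∈ insert v U, ξ u) *
          (Polynomial.X : Polynomial R) ^ (full π (insert v U)).card) *
        (Polynomial.X : Polynomial (Polynomial R)) ^ (half π (insert v U)).card =
      (∑ U ∈ S₀.powerset,
        Polynomial.C (Polynomial.C (∏ u ∈ U, ξ u) * (Polynomial.X : Polynomial R) ^ (full π U).card) *
          (Polynomial.X : Polynomial (Polynomial R)) ^ (half π U).card) *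
      (Polynomial.X * Polynomial.C (Polynomial.C (ξ v))) := by
    rw [sum_mul]
    refine sum_congr rfl fun U hU => ?_
    have hUS : U ⊆ S₀ := mem_powerset.1 hU
    have h1 : v ∉ U := fun h => hv (hUS h)
    have h2 : π v ∉ U := fun h => hπv (hUS h)
    rw [half_insert_of_notMem hπ hπ' h1 h2, full_insert_of_notMem hπ hπ' h1 h2,
      card_insert_of_notMem (fun h => h1 (mem_half.1 h).1), prod_insert h1, pow_succ]
    simp only [map_mul]
    ring
  have hC : ∑ U ∈ S₀.powerset,
      Polynomial.C (Polynomial.C (∏ u ∈ insert v (insert (π v) U), ξ u) *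
          (Polynomial.X : Polynomial R) ^ (full π (insert v (insert (π v) U))).card) *
        (Polynomial.X : Polynomial (Polynomial R)) ^ (half π (insert v (insert (π v) U))).card =
      (∑ U ∈ S₀.powerset,
        Polynomial.C (Polynomial.C (∏ u ∈ U, ξ u) * (Polynomial.X : Polynomial R) ^ (full π U).card) *
          (Polynomial.X : Polynomial (Polynomial R)) ^ (half π U).card) *
      Polynomial.C ((Polynomial.X : Polynomial R) ^ 2 * Polynomial.C (ξ v * ξ (π v))) := by
    rw [sum_mul]
    refine sum_congr rfl fun U hU => ?_
    have hUS : U ⊆ S₀ := mem_powerset.1 hU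
    have h1 : v ∉ U := fun h => hv (hUS h)
    have h2 : π v ∉ U := fun h => hπv (hUS h)
    have h3 : v ∉ insert (π v) U := by rw [mem_insert]; exact fun h => h.elim (fun h => hvπ h) h1
    rw [half_insert_insert_of_notMem hπ h1 h2, full_insert_insert_of_notMem hπ h1 h2,
      card_insert_of_notMem (by rw [mem_insert, mem_full]; exact fun h => h.elim (fun h => hvπ h) fun h => h1 h.1),
      card_insert_of_notMem (fun h => h2 (mem_full.1 h).1), prod_insert h3, prod_insert h2,
      pow_add, pow_succ, pow_succ]
    simp only [map_mul, map_pow]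
    ring
  rw [sum_powerset_insert hv', sum_powerset_insert hπv, sum_powerset_insert hπv, hA, hB, hC]
  ring

/-- **The coloured edge-product formula over representatives.** For representatives `Rr` (`v < πv`) of a
set of edges and any vertex weight `ξ`,
`Σ_{U ⊆ Rr ∪ πRr} (Π_{u∈U} ξ u) Y^{|full U|} Z^{|half U|} = Π_{v ∈ Rr} (1 + Z·ξ(πv) + Z·ξ(v) + Y²·ξ(v)ξ(πv))`.
[cite: Rothvoss2017, §2 (PDF p. 5)] [cite: GodsilMeagher2015, §15.2] -/
theorem colourGF_close_eq_prod (ξ : Fin n → R) {Rr : Finset (Fin n)} (hR : ∀ v ∈ Rr, v < π v) :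
    ∑ U ∈ (close π Rr).powerset,
        Polynomial.C (Polynomial.C (∏ u ∈ U, ξ u) * (Polynomial.X : Polynomial R) ^ (full π U).card) *
          (Polynomial.X : Polynomial (Polynomial R)) ^ (half π U).card =
      ∏ v ∈ Rr, (1 + Polynomial.X * Polynomial.C (Polynomial.C (ξ (π v)))
         + Polynomial.X * Polynomial.C (Polynomial.C (ξ v))
         + Polynomial.C ((Polynomial.X : Polynomial R) ^ 2 * Polynomial.C (ξ v * ξ (π v)))) := by
  classical
  induction Rr using Finset.induction_on with
  | empty =>
    rw [prod_empty]
    have : close π (∅ : Finset (Fin n)) = ∅ := by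
      ext v; rw [mem_close hπ]; simp
    rw [this, powerset_empty, sum_singleton]
    simp [half, full]
  | insert v Rr hvR ih =>
    have hR' : ∀ w ∈ Rr, w < π w := fun w hw => hR w (mem_insert_of_mem hw)
    have hvlt : v < π v := hR v (mem_insert_self v Rr)
    have hv : v ∉ close π Rr := by
      rw [mem_close hπ]
      rintro (h | h)
      · exact hvR h
      · have := hR' _ h; rw [hπ] at this; exact absurd (hvlt.trans this) (lt_irrefl _)
    have hπv : π v ∉ close π Rr := by
      rw [mem_close hπ, hπ]
      rintro (h | h)
      · have := hR' _ h; rw [hπ] at this; exact absurd (hvlt.trans this) (lt_irrefl _)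
      · exact hvR h
    have hclose : close π (insert v Rr) = insert v (insert (π v) (close π Rr)) := by
      ext u; simp only [mem_close hπ, mem_insert]
      constructor
      · rintro ((rfl | hu) | (h | hu))
        · exact Or.inl rfl
        · exact Or.inr (Or.inr (Or.inl hu))
        · exact Or.inr (Or.inl (by rw [← h, hπ]))
        · exact Or.inr (Or.inr (Or.inr hu))
      · rintro (rfl | rfl | (hu | hu))
        · exact Or.inl (Or.inl rfl)
        · exact Or.inr (Or.inl (by rw [hπ]))
        · exact Or.inl (Or.inr hu)
        · exact Or.inr (Or.inr hu)
    rw [hclose, colourGF_insert_insert hπ hπ' ξ hv hπv, ih hR', prod_insert hvR]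
    ring

/-- **The coloured edge-product formula.** For every `π`-stable ground set `S` and every vertex weight
`ξ : Fin n → R`:
`Σ_{U ⊆ S} (Π_{u∈U} ξ u)·Y^{|full U|}·Z^{|half U|} = Π_{v ∈ reps S} (1 + Z·ξ(πv) + Z·ξ(v) + Y²·ξ(v)ξ(πv))`.
The edge factor depends only on the colour pair `(ξ v, ξ (π v))`; with `ξ u = X^{[u ∈ H]}` this is
`shellGF_eq_prod`. [cite: Rothvoss2017, §2 (PDF p. 5)] [cite: GodsilMeagher2015, §15.2] -/
theorem colourGF_eq_prod (ξ : Fin n → R) {S : Finset (Fin n)} (hS : ∀ v ∈ S, π v ∈ S) :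
    ∑ U ∈ S.powerset,
        Polynomial.C (Polynomial.C (∏ u ∈ U, ξ u) * (Polynomial.X : Polynomial R) ^ (full π U).card) *
          (Polynomial.X : Polynomial (Polynomial R)) ^ (half π U).card =
      ∏ v ∈ reps π S, (1 + Polynomial.X * Polynomial.C (Polynomial.C (ξ (π v)))
         + Polynomial.X * Polynomial.C (Polynomial.C (ξ v))
         + Polynomial.C ((Polynomial.X : Polynomial R) ^ 2 * Polynomial.C (ξ v * ξ (π v)))) := by
  conv_lhs => rw [← close_reps hπ hπ' hS]
  exact colourGF_close_eq_prod hπ hπ' ξ fun v hv => (mem_reps.1 hv).2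

end Coloured

/-! ### §2 The universal exchange identity (every multi-block type step) -/

section Exchange

variable {A : Type*} [CommRing A]

/-- **Universal exchange identity.** With the edge factor `A_{ab} = 1 + Z·a + Z·b + Y²·ab` of a pair of
colours, `A_{ab}·A_{cd} − A_{ac}·A_{bd} = (Y² − Z²)·(a − d)·(b − c)` for all `a b c d` in any commutative
ring: trading an `(a,b)`- and a `(c,d)`-edge for an `(a,c)`- and a `(b,d)`-edge changes the coloured
generating function by `(Y²−Z²)` times a product of two first differences of the remainder's
generating function (`colourGF_eq_prod`). [cite: Rothvoss2017, §2 (PDF p. 5)] -/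
theorem edgeFactor_exchange (Y Z a b c d : A) :
    (1 + Z * a + Z * b + Y ^ 2 * (a * b)) * (1 + Z * c + Z * d + Y ^ 2 * (c * d)) -
        (1 + Z * a + Z * c + Y ^ 2 * (a * c)) * (1 + Z * b + Z * d + Y ^ 2 * (b * d)) =
      (Y ^ 2 - Z ^ 2) * (a - d) * (b - c) := by
  ring

/-- The same-colour case: `A_{aa}·A_{cc} − A_{ac}² = (Y² − Z²)·(a − c)²`.
[cite: Rothvoss2017, §2 (PDF p. 5)] -/
theorem edgeFactor_exchange_sq (Y Z a c : A) :
    (1 + Z * a + Z * a + Y ^ 2 * (a * a)) * (1 + Z * c + Z * c + Y ^ 2 * (c * c)) -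
        (1 + Z * a + Z * c + Y ^ 2 * (a * c)) ^ 2 =
      (Y ^ 2 - Z ^ 2) * (a - c) ^ 2 := by
  ring

/-- Two blocks, step `(11,22) ↔ (12,12)`: `A₁₁·A₂₂ − A₁₂² = (Y² − Z²)(X₁ − X₂)²`, with
`A₁₁ = 1 + 2ZX₁ + Y²X₁²`, `A₂₂ = 1 + 2ZX₂ + Y²X₂²`, `A₁₂ = 1 + ZX₁ + ZX₂ + Y²X₁X₂`.
[cite: Rothvoss2017, §2 (PDF p. 5)] -/
theorem edgeFactor_exchange_11_22 (Y Z X₁ X₂ : A) :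
    (1 + 2 * Z * X₁ + Y ^ 2 * X₁ ^ 2) * (1 + 2 * Z * X₂ + Y ^ 2 * X₂ ^ 2) -
        (1 + Z * X₁ + Z * X₂ + Y ^ 2 * (X₁ * X₂)) ^ 2 =
      (Y ^ 2 - Z ^ 2) * (X₁ - X₂) ^ 2 := by
  ring

/-- Two blocks, step `(12,00) ↔ (10,20)`: `A₁₂·A₀₀ − A₁₀·A₂₀ = (Y² − Z²)(1 − X₁)(1 − X₂)`, with
`A₀₀ = 1 + 2Z + Y²`, `A₁₀ = 1 + Z + ZX₁ + Y²X₁`, `A₂₀ = 1 + Z + ZX₂ + Y²X₂`.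
[cite: Rothvoss2017, §2 (PDF p. 5)] -/
theorem edgeFactor_exchange_12_00 (Y Z X₁ X₂ : A) :
    (1 + Z * X₁ + Z * X₂ + Y ^ 2 * (X₁ * X₂)) * (1 + 2 * Z + Y ^ 2) -
        (1 + Z + Z * X₁ + Y ^ 2 * X₁) * (1 + Z + Z * X₂ + Y ^ 2 * X₂) =
      (Y ^ 2 - Z ^ 2) * (1 - X₁) * (1 - X₂) := by
  ring

/-- Two blocks, step `(11,20) ↔ (12,10)`: `A₁₁·A₂₀ − A₁₂·A₁₀ = (Y² − Z²)(X₁ − 1)(X₁ − X₂)`.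
[cite: Rothvoss2017, §2 (PDF p. 5)] -/
theorem edgeFactor_exchange_11_20 (Y Z X₁ X₂ : A) :
    (1 + 2 * Z * X₁ + Y ^ 2 * X₁ ^ 2) * (1 + Z + Z * X₂ + Y ^ 2 * X₂) -
        (1 + Z * X₁ + Z * X₂ + Y ^ 2 * (X₁ * X₂)) * (1 + Z + Z * X₁ + Y ^ 2 * X₁) =
      (Y ^ 2 - Z ^ 2) * (X₁ - 1) * (X₁ - X₂) := by
  ring

/-- One block, step `(11,00) ↔ (10,10)` (= `typeStep_factor` of `ShellLawEdgeProduct.lean`, here for any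
commutative ring): `A₁₁·A₀₀ − A₁₀² = (Y² − Z²)(1 − X)²`. [cite: Rothvoss2017, §2 (PDF p. 5)] -/
theorem edgeFactor_exchange_11_00 (Y Z X : A) :
    (1 + 2 * Z * X + Y ^ 2 * X ^ 2) * (1 + 2 * Z + Y ^ 2) - (1 + Z + Z * X + Y ^ 2 * X) ^ 2 =
      (Y ^ 2 - Z ^ 2) * (1 - X) ^ 2 := by
  ring

end Exchange

/-! ### §3 Block weights as colour weights: one block and two blocks -/

section Blocks

variable {R : Type*} [CommRing R]

/-- `Π_{u ∈ U} X^{[u ∈ H]} = X^{|U ∩ H|}`: the one-block weight is the colour weight `ξ u = X^{[u∈H]}`.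
[cite: Rothvoss2017, §2 (PDF p. 5)] -/
theorem prod_pow_ite_mem_eq (X : R) (U H : Finset (Fin n)) :
    ∏ u ∈ U, X ^ (if u ∈ H then 1 else 0) = X ^ (U ∩ H).card := by
  classical
  have : ∀ u ∈ U, X ^ (if u ∈ H then 1 else 0) = if u ∈ H then X else 1 := by
    intro u _
    split_ifs <;> simp
  rw [prod_congr rfl this, prod_ite_mem, prod_const]

/-- `Π_{u ∈ U} X₁^{[u ∈ H₁]}·X₂^{[u ∈ H₂]} = X₁^{|U ∩ H₁|}·X₂^{|U ∩ H₂|}`: the two-block weight is the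
colour weight `ξ u = X₁^{[u∈H₁]}X₂^{[u∈H₂]}` (no disjointness of the blocks is needed).
[cite: Rothvoss2017, §2 (PDF p. 5)] -/
theorem prod_pow_ite_mem_mul_eq (X₁ X₂ : R) (U H₁ H₂ : Finset (Fin n)) :
    ∏ u ∈ U, (X₁ ^ (if u ∈ H₁ then 1 else 0) * X₂ ^ (if u ∈ H₂ then 1 else 0)) =
      X₁ ^ (U ∩ H₁).card * X₂ ^ (U ∩ H₂).card := by
  rw [prod_mul_distrib, prod_pow_ite_mem_eq, prod_pow_ite_mem_eq]

variable (hπ : ∀ v, π (π v) = v) (hπ' : ∀ v, π v ≠ v)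
include hπ hπ'

/-- **The two-block edge-product formula.** For a `π`-stable ground set `S`, blocks `H₁, H₂` and
`X₁, X₂` in any commutative ring `R`,
`Σ_{U ⊆ S} X₁^{|U∩H₁|}X₂^{|U∩H₂|}·Y^{|full U|}·Z^{|half U|} = Π_{v ∈ reps S} (1 + Z·ξ(πv) + Z·ξ(v) + Y²·ξ(v)ξ(πv))`
with `ξ u = X₁^{[u∈H₁]}X₂^{[u∈H₂]}`; for disjoint blocks the factor of an edge with endpoint colours
`(a,b) ∈ {0,1,2}²` is `A_{ab}` of §2 (`ξ = 1, X₁, X₂` on `H₀, H₁, H₂`), so `Ψ_S = Π_{ab} A_{ab}^{m_{ab}}` over the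
six edge classes. [cite: Rothvoss2017, §2 (PDF p. 5)] [cite: GodsilMeagher2015, §15.2] -/
theorem twoBlockGF_eq_prod (X₁ X₂ : R) (H₁ H₂ : Finset (Fin n)) {S : Finset (Fin n)}
    (hS : ∀ v ∈ S, π v ∈ S) :
    ∑ U ∈ S.powerset,
        Polynomial.C (Polynomial.C (X₁ ^ (U ∩ H₁).card * X₂ ^ (U ∩ H₂).card) *
            (Polynomial.X : Polynomial R) ^ (full π U).card) *
          (Polynomial.X : Polynomial (Polynomial R)) ^ (half π U).card =
      ∏ v ∈ reps π S,
        (1 + Polynomial.X * Polynomial.C (Polynomial.C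
              (X₁ ^ (if π v ∈ H₁ then 1 else 0) * X₂ ^ (if π v ∈ H₂ then 1 else 0)))
           + Polynomial.X * Polynomial.C (Polynomial.C
              (X₁ ^ (if v ∈ H₁ then 1 else 0) * X₂ ^ (if v ∈ H₂ then 1 else 0)))
           + Polynomial.C ((Polynomial.X : Polynomial R) ^ 2 * Polynomial.C
              ((X₁ ^ (if v ∈ H₁ then 1 else 0) * X₂ ^ (if v ∈ H₂ then 1 else 0)) *
               (X₁ ^ (if π v ∈ H₁ then 1 else 0) * X₂ ^ (if π v ∈ H₂ then 1 else 0))))) := by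
  have h := colourGF_eq_prod hπ hπ'
    (fun u => X₁ ^ (if u ∈ H₁ then 1 else 0) * X₂ ^ (if u ∈ H₂ then 1 else 0)) hS
  simp only [prod_pow_ite_mem_mul_eq] at h
  exact h

/-- The one-block formula recovered from the coloured one (cross-check against `shellGF_eq_prod`, for
any commutative ring): `Σ_{U ⊆ S} X^{|U∩H|}·Y^{|full U|}·Z^{|half U|} = Π_{v ∈ reps S} (1 + Z·X^{[πv∈H]} +
Z·X^{[v∈H]} + Y²·X^{[v∈H]}X^{[πv∈H]})`. [cite: Rothvoss2017, §2 (PDF p. 5)] -/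
theorem oneBlockGF_eq_prod (X : R) (H : Finset (Fin n)) {S : Finset (Fin n)}
    (hS : ∀ v ∈ S, π v ∈ S) :
    ∑ U ∈ S.powerset,
        Polynomial.C (Polynomial.C (X ^ (U ∩ H).card) * (Polynomial.X : Polynomial R) ^ (full π U).card) *
          (Polynomial.X : Polynomial (Polynomial R)) ^ (half π U).card =
      ∏ v ∈ reps π S,
        (1 + Polynomial.X * Polynomial.C (Polynomial.C (X ^ (if π v ∈ H then 1 else 0)))
           + Polynomial.X * Polynomial.C (Polynomial.C (X ^ (if v ∈ H then 1 else 0)))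
           + Polynomial.C ((Polynomial.X : Polynomial R) ^ 2 * Polynomial.C
              (X ^ (if v ∈ H then 1 else 0) * X ^ (if π v ∈ H then 1 else 0)))) := by
  have h := colourGF_eq_prod hπ hπ' (fun u => X ^ (if u ∈ H then 1 else 0)) hS
  simp only [prod_pow_ite_mem_eq] at h
  exact h

end Blocks

/-! ### §4 Disjoint blocks: grouping the edges by the nine ordered colour pairs

(Appended 2026-08-28, eng g21.) For DISJOINT blocks `H₁, H₂` every vertex has exactly one colour
`col u ∈ {0, 1, 2}` (`0` = outside both blocks) and the two-block weight is `ξ u = κ(col u)` with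
`κ = (1, X₁, X₂)`; grouping the representatives `v ∈ reps S` by the ordered pair `(col v, col (πv))` turns
the edge product into `Π_{(a,b) ∈ {0,1,2}²} A_{ab}^{m_{ab}}`, `A_{ab} = 1 + Z·κ_b + Z·κ_a + Y²·κ_aκ_b`,
`m_{ab} = #{v ∈ reps S : col v = a, col (πv) = b}` (`twoBlockGF_eq_prod_pairs`). Since `A_{ab} = A_{ba}`, the
six unordered classes of eng MEMO-20 §1.1 are obtained by merging `(a,b)` with `(b,a)`; the type steps
between class-count vectors are then `edgeFactor_exchange` (§2). -/

section Pairs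

variable {R : Type*} [CommRing R]

/-- For disjoint blocks the two-block vertex weight is a function of the colour: with
`col u = 1, 2, 0` on `H₁, H₂, outside` and `κ = (1, X₁, X₂)`, `X₁^{[u∈H₁]}·X₂^{[u∈H₂]} = κ(col u)`.
[cite: Rothvoss2017, §2 (PDF p. 5)] -/
theorem pow_ite_mul_pow_ite_eq_vec (X₁ X₂ : R) {H₁ H₂ : Finset (Fin n)} (hd : Disjoint H₁ H₂)
    (u : Fin n) :
    X₁ ^ (if u ∈ H₁ then 1 else 0) * X₂ ^ (if u ∈ H₂ then 1 else 0) =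
      ![(1 : R), X₁, X₂] (if u ∈ H₁ then (1 : Fin 3) else if u ∈ H₂ then 2 else 0) := by
  by_cases h1 : u ∈ H₁
  · have h2 : u ∉ H₂ := Finset.disjoint_left.1 hd h1
    simp [h1, h2]
  · by_cases h2 : u ∈ H₂
    · simp [h1, h2]
    · simp [h1, h2]

variable (hπ : ∀ v, π (π v) = v) (hπ' : ∀ v, π v ≠ v)
include hπ hπ'

/-- **Two disjoint blocks: `Ψ_S = Π_{(a,b)} A_{ab}^{m_{ab}}` over the nine ordered colour pairs.** With
`col u ∈ {0,1,2}` the colour of a vertex (`1` on `H₁`, `2` on `H₂`, `0` outside), `κ = (1, X₁, X₂)` and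
`m_{ab} = #{v ∈ reps S : (col v, col (πv)) = (a,b)}`:
`Σ_{U ⊆ S} X₁^{|U∩H₁|}X₂^{|U∩H₂|} Y^{|full U|} Z^{|half U|} = Π_{(a,b) ∈ Fin 3 × Fin 3} (1 + Z·κ_b + Z·κ_a + Y²·κ_aκ_b)^{m_{ab}}`.
(The factor is symmetric in `(a,b)`, so the unordered class counts of the two-block type are
`m_{ab} + m_{ba}` for `a ≠ b`.) [cite: Rothvoss2017, §2 (PDF p. 5)] [cite: GodsilMeagher2015, §15.2] -/
theorem twoBlockGF_eq_prod_pairs (X₁ X₂ : R) {H₁ H₂ : Finset (Fin n)} (hd : Disjoint H₁ H₂)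
    {S : Finset (Fin n)} (hS : ∀ v ∈ S, π v ∈ S) :
    ∑ U ∈ S.powerset,
        Polynomial.C (Polynomial.C (X₁ ^ (U ∩ H₁).card * X₂ ^ (U ∩ H₂).card) *
            (Polynomial.X : Polynomial R) ^ (full π U).card) *
          (Polynomial.X : Polynomial (Polynomial R)) ^ (half π U).card =
      ∏ p ∈ (Finset.univ : Finset (Fin 3 × Fin 3)),
        (1 + Polynomial.X * Polynomial.C (Polynomial.C (![(1 : R), X₁, X₂] p.2))
           + Polynomial.X * Polynomial.C (Polynomial.C (![(1 : R), X₁, X₂] p.1))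
           + Polynomial.C ((Polynomial.X : Polynomial R) ^ 2 *
               Polynomial.C (![(1 : R), X₁, X₂] p.1 * ![(1 : R), X₁, X₂] p.2))) ^
          ((reps π S).filter fun v =>
              ((if v ∈ H₁ then (1 : Fin 3) else if v ∈ H₂ then 2 else 0),
                (if π v ∈ H₁ then (1 : Fin 3) else if π v ∈ H₂ then 2 else 0)) = p).card := by
  classical
  rw [twoBlockGF_eq_prod hπ hπ' X₁ X₂ H₁ H₂ hS]
  -- rewrite every factor through the colour of its endpoints
  have hfac : ∀ v ∈ reps π S,
      (1 + Polynomial.X * Polynomial.C (Polynomial.C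
              (X₁ ^ (if π v ∈ H₁ then 1 else 0) * X₂ ^ (if π v ∈ H₂ then 1 else 0)))
           + Polynomial.X * Polynomial.C (Polynomial.C
              (X₁ ^ (if v ∈ H₁ then 1 else 0) * X₂ ^ (if v ∈ H₂ then 1 else 0)))
           + Polynomial.C ((Polynomial.X : Polynomial R) ^ 2 * Polynomial.C
              ((X₁ ^ (if v ∈ H₁ then 1 else 0) * X₂ ^ (if v ∈ H₂ then 1 else 0)) *
               (X₁ ^ (if π v ∈ H₁ then 1 else 0) * X₂ ^ (if π v ∈ H₂ then 1 else 0))))) =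
        (fun p : Fin 3 × Fin 3 =>
          (1 + Polynomial.X * Polynomial.C (Polynomial.C (![(1 : R), X₁, X₂] p.2))
             + Polynomial.X * Polynomial.C (Polynomial.C (![(1 : R), X₁, X₂] p.1))
             + Polynomial.C ((Polynomial.X : Polynomial R) ^ 2 *
                 Polynomial.C (![(1 : R), X₁, X₂] p.1 * ![(1 : R), X₁, X₂] p.2))))
          ((if v ∈ H₁ then (1 : Fin 3) else if v ∈ H₂ then 2 else 0),
            (if π v ∈ H₁ then (1 : Fin 3) else if π v ∈ H₂ then 2 else 0)) := by
    intro v _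
    simp only [pow_ite_mul_pow_ite_eq_vec X₁ X₂ hd]
  rw [prod_congr rfl hfac]
  rw [← prod_fiberwise_of_maps_to (s := reps π S) (t := (Finset.univ : Finset (Fin 3 × Fin 3)))
    (g := fun v => ((if v ∈ H₁ then (1 : Fin 3) else if v ∈ H₂ then 2 else 0),
            (if π v ∈ H₁ then (1 : Fin 3) else if π v ∈ H₂ then 2 else 0)))
    (fun _ _ => mem_univ _)]
  refine prod_congr rfl fun p _ => ?_
  rw [prod_congr rfl fun v hv => by rw [(mem_filter.1 hv).2], prod_const]

end Pairs

/-! ### §5 Coefficient extraction and transport for coloured / two-block shell generating polynomials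

(Appended 2026-08-28, eng g21.) The `Z^c Y^f` coefficient of the coloured generating function is the
coloured SHELL generating element `Σ_{U ∈ Shell_S(f+c,c)} Π_{u∈U} ξ u` (for two blocks: the joint shell
generating polynomial `Σ_{U ∈ Shell_S(f+c,c)} X₁^{|U∩H₁|}X₂^{|U∩H₂|}`, whose normalised coefficients are the
joint shell law of `(|U∩H₁|, |U∩H₂|)` of eng MEMO-20 §1.2); hence, by §4, for disjoint blocks the joint
shell law depends on the ground set only through the nine ordered colour-pair counts (TRANSPORT). -/

section Transport

variable {R : Type*} [CommRing R]

/-- **Coefficient extraction, coloured weights**: `[Y^f][Z^c] Σ_{U⊆S} (Πξ)·Y^{|full U|}Z^{|half U|} =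
Σ_{U ∈ Shell_S(f+c,c)} Π_{u∈U} ξ u`. [cite: Rothvoss2017, §2 (PDF p. 6)] -/
theorem coeff_coeff_colourGF (ξ : Fin n → R) (S : Finset (Fin n)) (c f : ℕ) :
    ((∑ U ∈ S.powerset, Polynomial.C (Polynomial.C (∏ u ∈ U, ξ u) *
          (Polynomial.X : Polynomial R) ^ (full π U).card) *
        (Polynomial.X : Polynomial (Polynomial R)) ^ (half π U).card).coeff c).coeff f =
      ∑ U ∈ shellIn π S (f + c) c, ∏ u ∈ U, ξ u := by
  rw [finsetSum_coeff, finsetSum_coeff]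
  simp only [coeff_C_mul_X_pow]
  rw [shellIn, sum_filter]
  refine sum_congr rfl fun U _ => ?_
  have hfh := card_full_add_card_half (π := π) U
  by_cases hc : c = (half π U).card
  · rw [if_pos hc, coeff_C_mul_X_pow]
    by_cases hf : f = (full π U).card
    · rw [if_pos hf, if_pos ⟨by omega, hc.symm⟩]
    · rw [if_neg hf, if_neg (by omega)]
  · rw [if_neg hc, coeff_zero, if_neg (fun h => hc h.2.symm)]

/-- **Coefficient extraction, two blocks**: `[Y^f][Z^c]` of the two-block generating function is the joint
shell generating polynomial `Σ_{U ∈ Shell_S(f+c,c)} X₁^{|U∩H₁|}·X₂^{|U∩H₂|}`.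
[cite: Rothvoss2017, §2 (PDF p. 6)] -/
theorem coeff_coeff_twoBlockGF (X₁ X₂ : R) (S H₁ H₂ : Finset (Fin n)) (c f : ℕ) :
    ((∑ U ∈ S.powerset, Polynomial.C (Polynomial.C (X₁ ^ (U ∩ H₁).card * X₂ ^ (U ∩ H₂).card) *
          (Polynomial.X : Polynomial R) ^ (full π U).card) *
        (Polynomial.X : Polynomial (Polynomial R)) ^ (half π U).card).coeff c).coeff f =
      ∑ U ∈ shellIn π S (f + c) c, X₁ ^ (U ∩ H₁).card * X₂ ^ (U ∩ H₂).card := by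
  have h := coeff_coeff_colourGF (π := π)
    (fun u => X₁ ^ (if u ∈ H₁ then 1 else 0) * X₂ ^ (if u ∈ H₂ then 1 else 0)) S c f
  simp only [prod_pow_ite_mem_mul_eq] at h
  exact h

variable (hπ : ∀ v, π (π v) = v) (hπ' : ∀ v, π v ≠ v)
include hπ hπ'

/-- **TRANSPORT for the two-block shell generating polynomial**: two `π`-stable ground sets with disjoint
block pairs `(H₁,H₂)`, `(H₁',H₂')` and the same nine ordered colour-pair counts
`m_{ab} = #{v ∈ reps S : (col v, col πv) = (a,b)}` have the same joint shell generating polynomial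
`Σ_{U ∈ Shell(t,c)} X₁^{|U∩H₁|}X₂^{|U∩H₂|}` for all `t, c` (hence the same joint shell laws of the two block
counts, the same shell sizes, the same marginals). [cite: Rothvoss2017, §2 (PDF p. 6)] -/
theorem twoBlockGen_eq_of_pairs_eq (X₁ X₂ : R) {H₁ H₂ H₁' H₂' : Finset (Fin n)}
    (hd : Disjoint H₁ H₂) (hd' : Disjoint H₁' H₂') {S S' : Finset (Fin n)}
    (hS : ∀ v ∈ S, π v ∈ S) (hS' : ∀ v ∈ S', π v ∈ S')
    (hm : ∀ p : Fin 3 × Fin 3,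
      ((reps π S).filter fun v =>
          ((if v ∈ H₁ then (1 : Fin 3) else if v ∈ H₂ then 2 else 0),
            (if π v ∈ H₁ then (1 : Fin 3) else if π v ∈ H₂ then 2 else 0)) = p).card =
      ((reps π S').filter fun v =>
          ((if v ∈ H₁' then (1 : Fin 3) else if v ∈ H₂' then 2 else 0),
            (if π v ∈ H₁' then (1 : Fin 3) else if π v ∈ H₂' then 2 else 0)) = p).card)
    (t c : ℕ) :
    ∑ U ∈ shellIn π S t c, X₁ ^ (U ∩ H₁).card * X₂ ^ (U ∩ H₂).card =
      ∑ U ∈ shellIn π S' t c, X₁ ^ (U ∩ H₁').card * X₂ ^ (U ∩ H₂').card := by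
  rcases Nat.lt_or_ge t c with htc | htc
  · rw [shellIn_eq_empty_of_lt S htc, shellIn_eq_empty_of_lt S' htc, sum_empty, sum_empty]
  · obtain ⟨f, rfl⟩ : ∃ f, t = f + c := ⟨t - c, by omega⟩
    have h1 := coeff_coeff_twoBlockGF (π := π) X₁ X₂ S H₁ H₂ c f
    have h2 := coeff_coeff_twoBlockGF (π := π) X₁ X₂ S' H₁' H₂' c f
    rw [twoBlockGF_eq_prod_pairs hπ hπ' X₁ X₂ hd hS] at h1
    rw [twoBlockGF_eq_prod_pairs hπ hπ' X₁ X₂ hd' hS'] at h2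
    have hprod :
        (∏ p ∈ (Finset.univ : Finset (Fin 3 × Fin 3)),
          (1 + Polynomial.X * Polynomial.C (Polynomial.C (![(1 : R), X₁, X₂] p.2))
             + Polynomial.X * Polynomial.C (Polynomial.C (![(1 : R), X₁, X₂] p.1))
             + Polynomial.C ((Polynomial.X : Polynomial R) ^ 2 *
                 Polynomial.C (![(1 : R), X₁, X₂] p.1 * ![(1 : R), X₁, X₂] p.2))) ^
            ((reps π S).filter fun v =>
                ((if v ∈ H₁ then (1 : Fin 3) else if v ∈ H₂ then 2 else 0),
                  (if π v ∈ H₁ then (1 : Fin 3) else if π v ∈ H₂ then 2 else 0)) = p).card) =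
        ∏ p ∈ (Finset.univ : Finset (Fin 3 × Fin 3)),
          (1 + Polynomial.X * Polynomial.C (Polynomial.C (![(1 : R), X₁, X₂] p.2))
             + Polynomial.X * Polynomial.C (Polynomial.C (![(1 : R), X₁, X₂] p.1))
             + Polynomial.C ((Polynomial.X : Polynomial R) ^ 2 *
                 Polynomial.C (![(1 : R), X₁, X₂] p.1 * ![(1 : R), X₁, X₂] p.2))) ^
            ((reps π S').filter fun v =>
                ((if v ∈ H₁' then (1 : Fin 3) else if v ∈ H₂' then 2 else 0),
                  (if π v ∈ H₁' then (1 : Fin 3) else if π v ∈ H₂' then 2 else 0)) = p).card :=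
      prod_congr rfl fun p _ => by rw [hm p]
    rw [hprod] at h1
    rw [← h1, ← h2]

end Transport

end ShellStep

end Literature.Combinatorics.Optimization

end
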